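import Summits.QuantumFields.YangMills.Theorems.FluctuationComparisonRegPrIntLS2BetaChartReadBkgLipschitz
import HarnessLib

/-!
# S2β · (REG-UP)′ bridge (O2-b1) — «THE ONE-STEP LINEARISED CHART MAP IS LIPSCHITZ IN THE BACKGROUND»: `‖↑(Dψ_{U₀}(0)Xc) − ↑(Dψ_{1}(0)Xc)‖ ≤ 2·(67ℓκ)·‖X‖∕a` when
# `‖U₀(b) − 1‖ ≤ κ` on the bonds issuing from `B(c₋) ∪ B(c₊)` (`100ℓκ ≤ ρ`), and hence `≤ 2·67ℓ(κ+κ′)·‖X‖∕a` between TWO backgrounds both locally close to `1` in a common gauge —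
# ✓p835572 C₂'s §6 (second-order remainder) read ONE derivative lower (first-order Cauchy, lit ✓`B7TransferAnalyticMean.norm_fderiv_apply_le_of_line`)

Cell `ym3-torus` (YM ladder rung R3 = continuum `SU(2)` Yang–Mills on the three-torus at fixed lattice data — a RUNG: NOT d = 4, NOT infinite volume, NOT a mass gap,
NOT Clay).  Width seat «width 12» `ym3-torus-px12` (gen 27); crux `stmt-QuantumFields-20520`, LINE g18-1 S2β, node (REG-UP)′ «the Prop-4 road» (px13 g29), binder `hDcov`:
the background-Lipschitz letter (O2-b) of the k-step map `DΨ_l(0)` telescopes (✓`fderiv_chartRead_iter_succ`) into ONE-STEP Lipschitz letters × k-step sup rows; THIS FILE is the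
one-step letter, in the WEAK form that suffices for `hDcov`'s BKG×size profile (the constant is the local flatness `κ` of each background, not their mutual distance).
`--kind proof --supports stmt-QuantumFields-20520 --as helper`, count-neutral, DEFINITION-FREE (0 `def`, 0 `instance`, 0 `notation`, 0 `sorry`, default heartbeats); generic
`P : Params`, `SU(N)`; hypotheses and complexified objects VERBATIM as in ✓`…ChartReadBkgLipschitz` §6 (`0 < ρ ≤ innerRadius`, loop guard `α` with `4α ≤ ρ`, standing range
`j + 1 ≤ m + K`, LOCAL letter `hκ`, `100ℓκ ≤ ρ`, radius `0 < a` with `100ℓ(e^a − 1) ≤ ρ`).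

WHAT IS PROVED (sorry-free).
* ★★★**`norm_fderiv_chartRead_sub_flat_le`** — **`‖↑((Dψ_{U₀}(0) X) c) − ↑((Dψ_{1}(0) X) c)‖ ≤ 2·(67·ℓ·κ)·‖X‖ ∕ a`** for EVERY direction `X` (no size constraint): `h := Φ^{U₀}_c − Φ^{1}_c` is
  holomorphic on the sup-ball of radius `a` with `‖h‖ ≤ 67ℓκ` (C₂ §5 ✓`norm_cplxChartRead_sub_cplxChartRead_one_le`), Cauchy's FIRST-order estimate at the centre, and the real slice
  ((β-2) ✓`coe_fderiv_chartRead_apply_eq` at `U₀` and at `1`).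
* ★★**`norm_fderiv_chartRead_sub_fderiv_le_of_local`** — two backgrounds `U₀`, `U₀′` both in the loop guard and both locally close to `1` (`κ`, `κ′`) on the read region of `c`:
  **`‖↑((Dψ_{U₀}(0) X) c) − ↑((Dψ_{U₀′}(0) X) c)‖ ≤ 2·(67·ℓ·(κ + κ′))·‖X‖ ∕ a`** (triangle through the flat background).
USE (hDcov): with the common block-pair axial gauge `h` of the background (door (α), lit ✓`T4AxialGaugeSmallField.axialGauge`: `‖(h•Ū^jU₀)(b) − 1‖ ≤ C(Lδ_j + α_j)` on `B(c₋) ∪ B(c₊)`)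
and the thin rectangle ✓`…ThinRectangleTransport` (`h•Ū^jU₀′` is then `κ + L^{l−j}α_j`-close to `1`), ✓p840250 (β′)_k moves both derivatives into `h`'s frame; the k-step telescope
multiplies by the sup rows ✓(D2); every constant is a (BKG) class — `β ∝ L^l·Σ_j κ_j·‖X₀‖ ∝ L^{2l}η²`-class at the representative.

HONEST SCOPE.  Cauchy-estimate bookkeeping over ✓p835572's landed complexification (`differentiableOn_cplxChartRead`, `analyticAt_cplxChartRead`, §5) and lit ✓`B7TransferAnalyticMean`; NO estimate
of Bałaban's renormalisation analysis is asserted or proved ([Balaban1985Averaging] Prop. 3 (121)–(125) p.36 «analytic in A», Prop. 4 (148)–(149) p.40 «Lipschitz» are the printed loci);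
the axial-gauge door (α), (O2-b2) the intermediate-level sup rows, `hDcov_of_letters`, (REG-UP)′, GAP♯∘ (`stub_uniformFibreGapOrbit`, registry 3732b7df UNTOUCHED, 0∕5), the five registered
stubs, S2β, crux 20520, 19936, 19200, `YM3TorusSU2` — NOT proved; no registered stub is closed; rung R3 — NOT d = 4, NOT infinite volume, NOT a mass gap, NOT Clay; the Yang–Mills mass gap
is NOT proved.
-/

set_option autoImplicit false

noncomputable section

open scoped Matrix.Norms.L2Operator Topology
open Filter Set Function Metric

namespace Summit.QuantumFields.YangMills.Theorems.FluctuationComparisonRegPrIntLS2BetaChartReadDerivBkgLipschitz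

open Literature.MathematicalPhysics.QuantumFieldTheory.Balaban1983to89
open Literature.MathematicalPhysics.QuantumFieldTheory.Balaban1983to89.HaarExponentialChart
open Literature.MathematicalPhysics.QuantumFieldTheory.Balaban1983to89.HaarExponentialChart.IsChartRep
open Literature.MathematicalPhysics.QuantumFieldTheory.Balaban1983to89.BlockAveraging (Small Idx avgFun loopHol off corr blockOf_src_of_mem_walk)
open Literature.MathematicalPhysics.QuantumFieldTheory.Balaban1983to89.ExpMeanLog (eml expMeanLogSU deltaSU deltaSU_pos)
open Literature.MathematicalPhysics.QuantumFieldTheory.Balaban1983to89.Node00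
open Literature.MathematicalPhysics.QuantumFieldTheory.Balaban1983to89.T4Continuum (walk holAt LStep loopWord)
open Literature.MathematicalPhysics.QuantumFieldTheory.Balaban1983to89.BlockAveragingEMLLinearised (length_walk length_walk_replicate_le)
open Literature.MathematicalPhysics.QuantumFieldTheory.Balaban1983to89.LatticeWordStokes (length_loopWord_le)
open Literature.MathematicalPhysics.QuantumFieldTheory.Balaban1983to89.BlockAveragingEMLAnalyticMean (eml_one norm_eml_add_sub_eml_le)
open MatrixLog (mlog mlog_one)
open Summit.QuantumFields.YangMills.BalabanUVNodes.N09ChartReadAveragingSmooth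
open Summit.QuantumFields.YangMills.BalabanUVNodes.N09CentralWindowInjective (norm_coe_SU_le_one)
open Summit.QuantumFields.YangMills.Theorems.FluctuationComparisonRegPrIntLS2BetaChartReadCplxExtension
open Summit.QuantumFields.YangMills.Theorems.FluctuationComparisonRegPrIntLS2BetaChartReadCplxAnalytic
open Summit.QuantumFields.BalabanUV.T4Continuum.Spine.NE7 (blockOf_src_of_mem_axWalk)
open Summit.QuantumFields.YangMills.Theorems.FluctuationComparisonRegPrIntLS2BetaChartReadBkgLetters
open Summit.QuantumFields.YangMills.Theorems.FluctuationComparisonRegPrIntLS2BetaChartReadBkgLipschitz (norm_cplxChartRead_sub_cplxChartRead_one_le)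

variable {P : Params} {j : ℕ} {N : ℕ} [NeZero N] (U₀ : GaugeField P j (SU N))

/-- ★★★ **THE ONE-STEP LINEARISED CHART MAP IS LIPSCHITZ IN THE BACKGROUND (against the flat one)** — see the module header. [cite: Balaban1985Averaging, Prop. 3 (121)-(125) p.36, Prop. 4 (148)-(149) p.40] -/
theorem norm_fderiv_chartRead_sub_flat_le (hj : j + 1 ≤ P.m + P.K) {α ρ : ℝ} (hρ0 : 0 < ρ) (hρ : ρ ≤ innerRadius (specialUnitaryLogChart (Fin N)))
    (hα : ∀ c i, dist1 (loopHol U₀ c i) ≤ α) (hα4 : 4 * α ≤ ρ) {κ : ℝ} (hκℓ : 100 * ((((P.d + 2) * P.L : ℕ) : ℝ) * κ) ≤ ρ) (c : PBond P (j + 1))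
    (hκ : ∀ b : PBond P j, (blockOf b.src = c.src ∨ blockOf b.src = c.tgt) → ‖((U₀ b : SU N) : Matrix (Fin N) (Fin N) ℂ) - 1‖ ≤ κ)
    {a : ℝ} (ha0 : 0 < a) (ha : 100 * ((((P.d + 2) * P.L : ℕ) : ℝ) * (Real.exp a - 1)) ≤ ρ) (X : PBond P j → (specialUnitaryLogChart (Fin N)).lie) :
    ‖((fderiv ℝ (fun (A : PBond P j → (specialUnitaryLogChart (Fin N)).lie) (c : PBond P (j + 1)) => (isChartRep_specialUnitaryGroup (n := Fin N)).logChart (avgFun (expMeanLogSU (n := Fin N)) (fun b => (isChartRep_specialUnitaryGroup (n := Fin N)).expChart (A b) * U₀ b) c * (avgFun (expMeanLogSU (n := Fin N)) U₀ c)⁻¹)) 0 X c : (specialUnitaryLogChart (Fin N)).lie) : Matrix (Fin N) (Fin N) ℂ) -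
        ((fderiv ℝ (fun (A : PBond P j → (specialUnitaryLogChart (Fin N)).lie) (c : PBond P (j + 1)) => (isChartRep_specialUnitaryGroup (n := Fin N)).logChart (avgFun (expMeanLogSU (n := Fin N)) (fun b => (isChartRep_specialUnitaryGroup (n := Fin N)).expChart (A b) * (1 : GaugeField P j (SU N)) b) c * (avgFun (expMeanLogSU (n := Fin N)) (1 : GaugeField P j (SU N)) c)⁻¹)) 0 X c : (specialUnitaryLogChart (Fin N)).lie) : Matrix (Fin N) (Fin N) ℂ)‖ ≤
      2 * (67 * ((((P.d + 2) * P.L : ℕ) : ℝ) * κ)) * ‖X‖ / a := by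
  have hα0 : 0 ≤ α := (GaugeGroup.dist1_nonneg _).trans (hα c (Classical.arbitrary _))
  have hα1 : ∀ c' i, dist1 (loopHol (1 : GaugeField P j (SU N)) c' i) ≤ α := fun c' i => by
    rw [T3DescentFibreTower.loopHol_one, GaugeGroup.dist1_one]; exact hα0
  have hκ0 : 0 ≤ κ := kappa_nonneg_of_local U₀ hj c hκ
  have hΦd : DifferentiableOn ℂ (fun A : PBond P j → Matrix (Fin N) (Fin N) ℂ => mlog (eml (fun i : Idx P => ((walk (emb c.src) (loopWord P.L c.dir (off i.1) i.2.1 i.2.2)).map (fun s : LStep P j => if s.fwd then NormedSpace.exp (A s.bond) * ((U₀ s.bond : SU N) : Matrix (Fin N) (Fin N) ℂ) else star ((U₀ s.bond : SU N) : Matrix (Fin N) (Fin N) ℂ) * NormedSpace.exp (-(A s.bond)))).prod) * ((walk (emb c.src) (List.replicate P.L (c.dir, true))).map (fun s : LStep P j => if s.fwd then NormedSpace.exp (A s.bond) * ((U₀ s.bond : SU N) : Matrix (Fin N) (Fin N) ℂ) else star ((U₀ s.bond : SU N) : Matrix (Fin N) (Fin N) ℂ) * NormedSpace.exp (-(A s.bond)))).prod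 * star ((avgFun (expMeanLogSU (n := Fin N)) U₀ c : SU N) : Matrix (Fin N) (Fin N) ℂ)) -
      mlog (eml (fun i : Idx P => ((walk (emb c.src) (loopWord P.L c.dir (off i.1) i.2.1 i.2.2)).map (fun s : LStep P j => if s.fwd then NormedSpace.exp (A s.bond) * (((1 : GaugeField P j (SU N)) s.bond : SU N) : Matrix (Fin N) (Fin N) ℂ) else star (((1 : GaugeField P j (SU N)) s.bond : SU N) : Matrix (Fin N) (Fin N) ℂ) * NormedSpace.exp (-(A s.bond)))).prod) * ((walk (emb c.src) (List.replicate P.L (c.dir, true))).map (fun s : LStep P j => if s.fwd then NormedSpace.exp (A s.bond) * (((1 : GaugeField P j (SU N)) s.bond : SU N) : Matrix (Fin N) (Fin N) ℂ) else star (((1 : GaugeField P j (SU N)) s.bond : SU N) : Matrix (Fin N) (Fin N) ℂ) * NormedSpace.exp (-(A s.bond)))).prod * star ((avgFun (expMeanLogSU (n := Fin N)) (1 : GaugeField P j (SU N)) c : SU N) : Matrix (Fin N) (Fin N) ℂ))) (ball (0 : PBond P j → Matrix (Fin N) (Fin N) ℂ) a) :=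
    (differentiableOn_cplxChartRead U₀ c hρ (hα c) hα4 ha).sub (differentiableOn_cplxChartRead (1 : GaugeField P j (SU N)) c hρ (hα1 c) hα4 ha)
  have hB : ∀ A ∈ ball (0 : PBond P j → Matrix (Fin N) (Fin N) ℂ) a, ‖mlog (eml (fun i : Idx P => ((walk (emb c.src) (loopWord P.L c.dir (off i.1) i.2.1 i.2.2)).map (fun s : LStep P j => if s.fwd then NormedSpace.exp (A s.bond) * ((U₀ s.bond : SU N) : Matrix (Fin N) (Fin N) ℂ) else star ((U₀ s.bond : SU N) : Matrix (Fin N) (Fin N) ℂ) * NormedSpace.exp (-(A s.bond)))).prod) * ((walk (emb c.src) (List.replicate P.L (c.dir, true))).map (fun s : LStep P j => if s.fwd then NormedSpace.exp (A s.bond) * ((U₀ s.bond : SU N) : Matrix (Fin N) (Fin N) ℂ) else star ((U₀ s.bond : SU N) : Matrix (Fin N) (Fin N) ℂ) * NormedSpace.exp (-(A s.bond)))).prod * star ((avgFun (expMeanLogSU (n := Fin N)) U₀ c : SU N) : Matrix (Fin N) (Fin N) ℂ)) -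
      mlog (eml (fun i : Idx P => ((walk (emb c.src) (loopWord P.L c.dir (off i.1) i.2.1 i.2.2)).map (fun s : LStep P j => if s.fwd then NormedSpace.exp (A s.bond) * (((1 : GaugeField P j (SU N)) s.bond : SU N) : Matrix (Fin N) (Fin N) ℂ) else star (((1 : GaugeField P j (SU N)) s.bond : SU N) : Matrix (Fin N) (Fin N) ℂ) * NormedSpace.exp (-(A s.bond)))).prod) * ((walk (emb c.src) (List.replicate P.L (c.dir, true))).map (fun s : LStep P j => if s.fwd then NormedSpace.exp (A s.bond) * (((1 : GaugeField P j (SU N)) s.bond : SU N) : Matrix (Fin N) (Fin N) ℂ) else star (((1 : GaugeField P j (SU N)) s.bond : SU N) : Matrix (Fin N) (Fin N) ℂ) * NormedSpace.exp (-(A s.bond)))).prod * star ((avgFun (expMeanLogSU (n := Fin N)) (1 : GaugeField P j (SU N)) c : SU N) : Matrix (Fin N) (Fin N) ℂ))‖ ≤ 67 * ((((P.d + 2) * P.L : ℕ) : ℝ) * κ) := by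
    intro A hAball
    have hAa : ‖A‖ ≤ a := (mem_ball_zero_iff.1 hAball).le
    have hmono : Real.exp ‖A‖ - 1 ≤ Real.exp a - 1 := by linarith [Real.exp_le_exp.2 hAa]
    exact norm_cplxChartRead_sub_cplxChartRead_one_le U₀ hj c hρ hκℓ hκ A (le_trans (by gcongr) ha)
  have hXh : ‖(fun b => ((X b : (specialUnitaryLogChart (Fin N)).lie) : Matrix (Fin N) (Fin N) ℂ))‖ ≤ ‖X‖ := norm_coePi_le X
  have hu : (0 : PBond P j → Matrix (Fin N) (Fin N) ℂ) ∈ ball (0 : PBond P j → Matrix (Fin N) (Fin N) ℂ) a := mem_ball_self ha0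
  have h := B7TransferAnalyticMean.norm_fderiv_apply_le_of_line hΦd hB hu (fun b => ((X b : (specialUnitaryLogChart (Fin N)).lie) : Matrix (Fin N) (Fin N) ℂ))
  have hd₀ : DifferentiableAt ℂ (fun A : PBond P j → Matrix (Fin N) (Fin N) ℂ => mlog (eml (fun i : Idx P => ((walk (emb c.src) (loopWord P.L c.dir (off i.1) i.2.1 i.2.2)).map (fun s : LStep P j => if s.fwd then NormedSpace.exp (A s.bond) * ((U₀ s.bond : SU N) : Matrix (Fin N) (Fin N) ℂ) else star ((U₀ s.bond : SU N) : Matrix (Fin N) (Fin N) ℂ) * NormedSpace.exp (-(A s.bond)))).prod) * ((walk (emb c.src) (List.replicate P.L (c.dir, true))).map (fun s : LStep P j => if s.fwd then NormedSpace.exp (A s.bond) * ((U₀ s.bond : SU N) : Matrix (Fin N) (Fin N) ℂ) else star ((U₀ s.bond : SU N) : Matrix (Fin N) (Fin N) ℂ) * NormedSpace.exp (-(A s.bond)))).prod * star ((avgFun (expMeanLogSU (n := Fin N)) U₀ c : SU N) : Matrix (Fin N) (Fin N) ℂ))) 0 :=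
    (analyticAt_cplxChartRead U₀ c hρ (hα c) hα4 0 (by rw [norm_zero, Real.exp_zero, sub_self, mul_zero, mul_zero]; exact hρ0.le)).differentiableAt
  have hd₁ : DifferentiableAt ℂ (fun A : PBond P j → Matrix (Fin N) (Fin N) ℂ => mlog (eml (fun i : Idx P => ((walk (emb c.src) (loopWord P.L c.dir (off i.1) i.2.1 i.2.2)).map (fun s : LStep P j => if s.fwd then NormedSpace.exp (A s.bond) * (((1 : GaugeField P j (SU N)) s.bond : SU N) : Matrix (Fin N) (Fin N) ℂ) else star (((1 : GaugeField P j (SU N)) s.bond : SU N) : Matrix (Fin N) (Fin N) ℂ) * NormedSpace.exp (-(A s.bond)))).prod) * ((walk (emb c.src) (List.replicate P.L (c.dir, true))).map (fun s : LStep P j => if s.fwd then NormedSpace.exp (A s.bond) * (((1 : GaugeField P j (SU N)) s.bond : SU N) : Matrix (Fin N) (Fin N) ℂ) else star (((1 : GaugeField P j (SU N)) s.bond : SU N) : Matrix (Fin N) (Fin N) ℂ) * NormedSpace.exp (-(A s.bond)))).prod * star ((avgFun (expMeanLogSU (n := Fin N)) (1 : GaugeField P j (SU N)) c : SU N) : Matrix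 (Fin N) (Fin N) ℂ))) 0 :=
    (analyticAt_cplxChartRead (1 : GaugeField P j (SU N)) c hρ (hα1 c) hα4 0 (by rw [norm_zero, Real.exp_zero, sub_self, mul_zero, mul_zero]; exact hρ0.le)).differentiableAt
  rw [fderiv_fun_sub hd₀ hd₁, sub_apply, sub_self, norm_zero, sub_zero] at h
  -- read on the real slice
  rw [← coe_fderiv_chartRead_apply_eq U₀ hρ hα hα4 hρ0 X c, ← coe_fderiv_chartRead_apply_eq (1 : GaugeField P j (SU N)) hρ hα1 hα4 hρ0 X c] at h
  have hB0 : 0 ≤ 2 * (67 * ((((P.d + 2) * P.L : ℕ) : ℝ) * κ)) := by positivity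
  calc _ ≤ 2 * (67 * ((((P.d + 2) * P.L : ℕ) : ℝ) * κ)) * ‖(fun b => ((X b : (specialUnitaryLogChart (Fin N)).lie) : Matrix (Fin N) (Fin N) ℂ))‖ / a := h
    _ ≤ 2 * (67 * ((((P.d + 2) * P.L : ℕ) : ℝ) * κ)) * ‖X‖ / a := by gcongr

/-- ★★ **TWO BACKGROUNDS, BOTH LOCALLY CLOSE TO `1` IN A COMMON GAUGE**: `‖↑((Dψ_{U₀}(0) X) c) − ↑((Dψ_{U₀′}(0) X) c)‖ ≤ 2·(67·ℓ·(κ + κ′))·‖X‖ ∕ a` (triangle through the flat background;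
the common block-pair axial gauge and ✓p840250's covariance move an arbitrary pair here). [cite: Balaban1985Averaging, Prop. 3 (121)-(125) p.36, Prop. 4 (148)-(149) p.40] -/
theorem norm_fderiv_chartRead_sub_fderiv_le_of_local (U₀' : GaugeField P j (SU N)) (hj : j + 1 ≤ P.m + P.K) {α ρ : ℝ} (hρ0 : 0 < ρ) (hρ : ρ ≤ innerRadius (specialUnitaryLogChart (Fin N)))
    (hα : ∀ c i, dist1 (loopHol U₀ c i) ≤ α) (hα' : ∀ c i, dist1 (loopHol U₀' c i) ≤ α) (hα4 : 4 * α ≤ ρ) {κ κ' : ℝ}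
    (hκℓ : 100 * ((((P.d + 2) * P.L : ℕ) : ℝ) * κ) ≤ ρ) (hκℓ' : 100 * ((((P.d + 2) * P.L : ℕ) : ℝ) * κ') ≤ ρ) (c : PBond P (j + 1))
    (hκ : ∀ b : PBond P j, (blockOf b.src = c.src ∨ blockOf b.src = c.tgt) → ‖((U₀ b : SU N) : Matrix (Fin N) (Fin N) ℂ) - 1‖ ≤ κ)
    (hκ' : ∀ b : PBond P j, (blockOf b.src = c.src ∨ blockOf b.src = c.tgt) → ‖((U₀' b : SU N) : Matrix (Fin N) (Fin N) ℂ) - 1‖ ≤ κ')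
    {a : ℝ} (ha0 : 0 < a) (ha : 100 * ((((P.d + 2) * P.L : ℕ) : ℝ) * (Real.exp a - 1)) ≤ ρ) (X : PBond P j → (specialUnitaryLogChart (Fin N)).lie) :
    ‖((fderiv ℝ (fun (A : PBond P j → (specialUnitaryLogChart (Fin N)).lie) (c : PBond P (j + 1)) => (isChartRep_specialUnitaryGroup (n := Fin N)).logChart (avgFun (expMeanLogSU (n := Fin N)) (fun b => (isChartRep_specialUnitaryGroup (n := Fin N)).expChart (A b) * U₀ b) c * (avgFun (expMeanLogSU (n := Fin N)) U₀ c)⁻¹)) 0 X c : (specialUnitaryLogChart (Fin N)).lie) : Matrix (Fin N) (Fin N) ℂ) -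
        ((fderiv ℝ (fun (A : PBond P j → (specialUnitaryLogChart (Fin N)).lie) (c : PBond P (j + 1)) => (isChartRep_specialUnitaryGroup (n := Fin N)).logChart (avgFun (expMeanLogSU (n := Fin N)) (fun b => (isChartRep_specialUnitaryGroup (n := Fin N)).expChart (A b) * U₀' b) c * (avgFun (expMeanLogSU (n := Fin N)) U₀' c)⁻¹)) 0 X c : (specialUnitaryLogChart (Fin N)).lie) : Matrix (Fin N) (Fin N) ℂ)‖ ≤
      2 * (67 * ((((P.d + 2) * P.L : ℕ) : ℝ) * (κ + κ'))) * ‖X‖ / a := by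
  have h₀ := norm_fderiv_chartRead_sub_flat_le U₀ hj hρ0 hρ hα hα4 hκℓ c hκ ha0 ha X
  have h₁ := norm_fderiv_chartRead_sub_flat_le U₀' hj hρ0 hρ hα' hα4 hκℓ' c hκ' ha0 ha X
  calc ‖((fderiv ℝ (fun (A : PBond P j → (specialUnitaryLogChart (Fin N)).lie) (c : PBond P (j + 1)) => (isChartRep_specialUnitaryGroup (n := Fin N)).logChart (avgFun (expMeanLogSU (n := Fin N)) (fun b => (isChartRep_specialUnitaryGroup (n := Fin N)).expChart (A b) * U₀ b) c * (avgFun (expMeanLogSU (n := Fin N)) U₀ c)⁻¹)) 0 X c : (specialUnitaryLogChart (Fin N)).lie) : Matrix (Fin N) (Fin N) ℂ) -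
        ((fderiv ℝ (fun (A : PBond P j → (specialUnitaryLogChart (Fin N)).lie) (c : PBond P (j + 1)) => (isChartRep_specialUnitaryGroup (n := Fin N)).logChart (avgFun (expMeanLogSU (n := Fin N)) (fun b => (isChartRep_specialUnitaryGroup (n := Fin N)).expChart (A b) * U₀' b) c * (avgFun (expMeanLogSU (n := Fin N)) U₀' c)⁻¹)) 0 X c : (specialUnitaryLogChart (Fin N)).lie) : Matrix (Fin N) (Fin N) ℂ)‖
      ≤ ‖((fderiv ℝ (fun (A : PBond P j → (specialUnitaryLogChart (Fin N)).lie) (c : PBond P (j + 1)) => (isChartRep_specialUnitaryGroup (n := Fin N)).logChart (avgFun (expMeanLogSU (n := Fin N)) (fun b => (isChartRep_specialUnitaryGroup (n := Fin N)).expChart (A b) * U₀ b) c * (avgFun (expMeanLogSU (n := Fin N)) U₀ c)⁻¹)) 0 X c : (specialUnitaryLogChart (Fin N)).lie) : Matrix (Fin N) (Fin N) ℂ) -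
        ((fderiv ℝ (fun (A : PBond P j → (specialUnitaryLogChart (Fin N)).lie) (c : PBond P (j + 1)) => (isChartRep_specialUnitaryGroup (n := Fin N)).logChart (avgFun (expMeanLogSU (n := Fin N)) (fun b => (isChartRep_specialUnitaryGroup (n := Fin N)).expChart (A b) * (1 : GaugeField P j (SU N)) b) c * (avgFun (expMeanLogSU (n := Fin N)) (1 : GaugeField P j (SU N)) c)⁻¹)) 0 X c : (specialUnitaryLogChart (Fin N)).lie) : Matrix (Fin N) (Fin N) ℂ)‖ +
        ‖((fderiv ℝ (fun (A : PBond P j → (specialUnitaryLogChart (Fin N)).lie) (c : PBond P (j + 1)) => (isChartRep_specialUnitaryGroup (n := Fin N)).logChart (avgFun (expMeanLogSU (n := Fin N)) (fun b => (isChartRep_specialUnitaryGroup (n := Fin N)).expChart (A b) * U₀' b) c * (avgFun (expMeanLogSU (n := Fin N)) U₀' c)⁻¹)) 0 X c : (specialUnitaryLogChart (Fin N)).lie) : Matrix (Fin N) (Fin N) ℂ) -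
        ((fderiv ℝ (fun (A : PBond P j → (specialUnitaryLogChart (Fin N)).lie) (c : PBond P (j + 1)) => (isChartRep_specialUnitaryGroup (n := Fin N)).logChart (avgFun (expMeanLogSU (n := Fin N)) (fun b => (isChartRep_specialUnitaryGroup (n := Fin N)).expChart (A b) * (1 : GaugeField P j (SU N)) b) c * (avgFun (expMeanLogSU (n := Fin N)) (1 : GaugeField P j (SU N)) c)⁻¹)) 0 X c : (specialUnitaryLogChart (Fin N)).lie) : Matrix (Fin N) (Fin N) ℂ)‖ := by
          rw [← norm_neg (((fderiv ℝ (fun (A : PBond P j → (specialUnitaryLogChart (Fin N)).lie) (c : PBond P (j + 1)) => (isChartRep_specialUnitaryGroup (n := Fin N)).logChart (avgFun (expMeanLogSU (n := Fin N)) (fun b => (isChartRep_specialUnitaryGroup (n := Fin N)).expChart (A b) * U₀' b) c * (avgFun (expMeanLogSU (n := Fin N)) U₀' c)⁻¹)) 0 X c : (specialUnitaryLogChart (Fin N)).lie) : Matrix (Fin N) (Fin N) ℂ) -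
            ((fderiv ℝ (fun (A : PBond P j → (specialUnitaryLogChart (Fin N)).lie) (c : PBond P (j + 1)) => (isChartRep_specialUnitaryGroup (n := Fin N)).logChart (avgFun (expMeanLogSU (n := Fin N)) (fun b => (isChartRep_specialUnitaryGroup (n := Fin N)).expChart (A b) * (1 : GaugeField P j (SU N)) b) c * (avgFun (expMeanLogSU (n := Fin N)) (1 : GaugeField P j (SU N)) c)⁻¹)) 0 X c : (specialUnitaryLogChart (Fin N)).lie) : Matrix (Fin N) (Fin N) ℂ))] 
          refine le_trans (le_of_eq ?_) (norm_add_le _ _)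
          congr 1; abel
    _ ≤ 2 * (67 * ((((P.d + 2) * P.L : ℕ) : ℝ) * κ)) * ‖X‖ / a + 2 * (67 * ((((P.d + 2) * P.L : ℕ) : ℝ) * κ')) * ‖X‖ / a := add_le_add h₀ h₁
    _ = 2 * (67 * ((((P.d + 2) * P.L : ℕ) : ℝ) * (κ + κ'))) * ‖X‖ / a := by ring

end Summit.QuantumFields.YangMills.Theorems.FluctuationComparisonRegPrIntLS2BetaChartReadDerivBkgLipschitz

end
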